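import Mathlib
import HarnessLib
import Summits.HubbardSuperconductivity.HubbardSuperconductivity.Theorems.KLProgrammeDispersionFlowEnvelope
import Summits.HubbardSuperconductivity.HubbardSuperconductivity.Theorems.KLProgrammeFermiSurfaceFST2Regularity
import Summits.HubbardSuperconductivity.HubbardSuperconductivity.Theorems.KLProgrammeFermiSurfaceFST2Constants

/-!
# Route `KLProgramme` (crux K3 `KLRegimeTwoPointLimit`, stmt-HubbardSuperconductivity-19937) — the dispersion-flow
# invariant (I_h) on the certified window: the scale-`h` Fermi curves keep FST II's constants, uniformly in `h`

Cell `gate-hubbard-kl`, seat p2; continues `KLProgrammeDispersionFlowEnvelope.lean`.  On the certified window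
`μ ∈ [-0.4267, -0.1798]` (⟸ `δ ∈ [0.10, 0.20]`, risk-register item r2) the free band has
`GeomConstants (ε - μ) 4.4267 0.0899 0.579 0.0449` (fs-1, `klfs_window_geomConstants`).  We PROVE:

* `geomConstants_effLevel_window`: a dispersion family with BGM's initial condition `E_0 ≡ ε` satisfying (I_h) with
  weight `0 ≤ w ≤ W` down to `h_β` (tube `ē ≥ 0.0899`), under the smallness `(16/15)A₀W|U| ≤ 0.04495`,
  `(4/3)A₁WU² ≤ 0.001158`, `bU² ≤ 0.01` — NO condition on the second-order constant `A₂` — has, at EVERY scale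
  `h_β ≤ h ≤ 0`, `GeomConstants (ε_h - μ) (4.4267 + max(0.04495, 0.001158, A₂WU²|h|)) 0.04495 0.577842 0.0169`: on the
  tube `{|e_h| < 0.04495}` the scale-`h` curves have `|∇e_h| ≥ 0.5778` and tangential Hessian `≥ 0.0169|t|²` — the
  lower end does not see `|h|` (BGM06 Lemma 2.1 (1)–(2) in the KL regime, modulo (I_h));
* `geomConstants_effLevel_window_kl`: in the KL regime `U²|h| log 4 ≤ c` also the `C²` bound is `h`-uniform,
  `4.4267 + max(0.04495, 0.001158, A₂Wc/log 4)` (the upper curvature end `κ₀ + Kc` of DECOMP C4b);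
* `geomConstants_frameLevel_window`: the frame form (`FrameGeometry` ⟹ the renormalised band `ε - μ - K` of the
  cell's model-bound carrier keeps the constants, whatever `‖D²K‖`).

Everything PROVED; no definitions. References: BGM06 Lemma 2.1 [BenfattoGiulianiMastropietro2006]; FST II §2
[FeldmanSalmhoferTrubowitz1998]; HOME/P2-C4B.md §5; HOME/FS-WINDOW.md.
-/

noncomputable section

-- the tree's namespace `Summit.<Summit>.<Problem>.Theorems` repeats the summit name by design (D-0017)
set_option linter.dupNamespace false

namespace Summit.HubbardSuperconductivity.HubbardSuperconductivity.Theorems.DispersionFlow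

open Set Real
open scoped Topology InnerProductSpace
open Literature.MathematicalPhysics.QuantumLattice Literature.MathematicalPhysics.QuantumLattice.FermiRG
open Summit.HubbardSuperconductivity.HubbardSuperconductivity.Theorems

/-- The arithmetic of the window constants: with `ρ = a₁/0.579 ≤ 0.002` and `bU² ≤ 0.01`,
`0.0449(1-ρ)² - 4.4267ρ(2+3ρ) - bU² ≥ 0.0169`. -/
theorem window_wmin_bound {a₁ b : ℝ} (ha₁0 : 0 ≤ a₁) (ha₁ : a₁ ≤ 0.001158) (hb : b ≤ 0.01) :
    0.0169 ≤ 0.0449 * (1 - a₁ / 0.579) ^ 2 - 4.4267 * (a₁ / 0.579) * (2 + 3 * (a₁ / 0.579)) - b := by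
  have hρ0 : 0 ≤ a₁ / 0.579 := by positivity
  have hρ1 : a₁ / 0.579 ≤ 0.002 := by rw [div_le_iff₀ (by norm_num)]; linarith
  nlinarith [mul_nonneg hρ0 hρ0, mul_le_mul hρ1 hρ1 hρ0 (by norm_num)]

/-- **The scale-`h` Fermi curves on the certified window keep FST II's constants** (modulo (I_h); BGM06 Lemma 2.1
(1)–(2), KL regime).  For `μ ∈ [-0.4267, -0.1798]`, a dispersion family `E` with `E_0 ≡ ε` satisfying
`DispersionFlow β U μ κ w hβ E` with `0 ≤ w ≤ W`, `κ.ebar ≥ 0.0899`, and the smallness `(16/15)A₀W|U| ≤ 0.04495`,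
`(4/3)A₁WU² ≤ 0.001158`, `bU² ≤ 0.01` (none on `A₂`): for every `h_β ≤ h ≤ 0`,
`GeomConstants (ε_h - μ) (4.4267 + max((16/15)A₀W|U|, (4/3)A₁WU², A₂WU²|h|)) 0.04495 0.577842 0.0169`. -/
theorem geomConstants_effLevel_window {β U μ W : ℝ} {κ : KLFlowConstants} {w : ℤ → ℝ} {hβ : ℤ}
    {E : ℤ → ℝ × (Fin 2 → ℝ) → ℂ} (hμ : μ ∈ Icc (-0.4267 : ℝ) (-0.1798)) (hE : BGMInitial E)
    (hyp : DispersionFlow β U μ κ w hβ E)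
    (hw : ∀ j, hβ ≤ j → j ≤ 0 → 0 ≤ w j ∧ w j ≤ W) (hA₀ : 0 ≤ κ.A₀) (hA₁ : 0 ≤ κ.A₁) (hA₂ : 0 ≤ κ.A₂)
    (hebar : 0.0899 ≤ κ.ebar) (hs₀ : 16 / 15 * κ.A₀ * W * |U| ≤ 0.04495)
    (hs₁ : 4 / 3 * κ.A₁ * W * U ^ 2 ≤ 0.001158) (hsb : κ.b * U ^ 2 ≤ 0.01)
    {h : ℤ} (hh₁ : hβ ≤ h) (hh₂ : h ≤ 0) :
    GeomConstants (effLevel β μ E h)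
      (4.4267 + max (16 / 15 * κ.A₀ * W * |U|) (max (4 / 3 * κ.A₁ * W * U ^ 2) (κ.A₂ * W * U ^ 2 * |(h : ℝ)|)))
      0.04495 0.577842 0.0169 := by
  have hG0 : GeomConstants (effLevel β μ E 0) 4.4267 0.0899 0.579 0.0449 := by
    rw [effLevel_zero_of_initial hE]
    exact klfs_window_geomConstants hμ
  obtain ⟨hw0, hwW⟩ := hw 0 (hh₁.trans hh₂) le_rfl
  have hW : 0 ≤ W := hw0.trans hwW
  have ha₁0 : 0 ≤ 4 / 3 * κ.A₁ * W * U ^ 2 := by positivity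
  have ha₀ : 16 / 15 * κ.A₀ * W * |U| < 0.0899 := by linarith
  have ha₁ : 4 / 3 * κ.A₁ * W * U ^ 2 < 0.579 := by linarith
  have hwb := window_wmin_bound ha₁0 hs₁ hsb
  have hw' : 0 < 0.0449 * (1 - 4 / 3 * κ.A₁ * W * U ^ 2 / 0.579) ^ 2 -
      4.4267 * (4 / 3 * κ.A₁ * W * U ^ 2 / 0.579) * (2 + 3 * (4 / 3 * κ.A₁ * W * U ^ 2 / 0.579)) -
      κ.b * U ^ 2 := by linarith
  have main := geomConstants_effLevel hyp hw hA₀ hA₁ hA₂ hG0 ha₀ hebar ha₁ hw' hh₁ hh₂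
  exact GeomConstants.weaken main le_rfl (by linarith) (by linarith) hwb (by norm_num) (by norm_num) (by norm_num)

/-- **KL regime: `h`-uniform constants.**  Under `U²|h| log 4 ≤ c` the second-order size is `≤ A₂Wc/log 4`, so
`GeomConstants (ε_h - μ) (4.4267 + max(0.04495, 0.001158, A₂Wc/log 4)) 0.04495 0.577842 0.0169` — every constant
independent of `h`: the curvature envelope `[κ₀ - CU², κ₀ + Kc]` of DECOMP C4b in FST's typed vocabulary. -/
theorem geomConstants_effLevel_window_kl {β U μ W c : ℝ} {κ : KLFlowConstants} {w : ℤ → ℝ} {hβ : ℤ}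
    {E : ℤ → ℝ × (Fin 2 → ℝ) → ℂ} (hμ : μ ∈ Icc (-0.4267 : ℝ) (-0.1798)) (hE : BGMInitial E)
    (hyp : DispersionFlow β U μ κ w hβ E)
    (hw : ∀ j, hβ ≤ j → j ≤ 0 → 0 ≤ w j ∧ w j ≤ W) (hA₀ : 0 ≤ κ.A₀) (hA₁ : 0 ≤ κ.A₁) (hA₂ : 0 ≤ κ.A₂)
    (hebar : 0.0899 ≤ κ.ebar) (hs₀ : 16 / 15 * κ.A₀ * W * |U| ≤ 0.04495)
    (hs₁ : 4 / 3 * κ.A₁ * W * U ^ 2 ≤ 0.001158) (hsb : κ.b * U ^ 2 ≤ 0.01)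
    {h : ℤ} (hh₁ : hβ ≤ h) (hh₂ : h ≤ 0) (hkl : IsKLRegime U c h) :
    GeomConstants (effLevel β μ E h) (4.4267 + max 0.04495 (max 0.001158 (κ.A₂ * W * c / Real.log 4)))
      0.04495 0.577842 0.0169 := by
  have main := geomConstants_effLevel_window hμ hE hyp hw hA₀ hA₁ hA₂ hebar hs₀ hs₁ hsb hh₁ hh₂
  obtain ⟨hw0, hwW⟩ := hw 0 (hh₁.trans hh₂) le_rfl
  have hW : 0 ≤ W := hw0.trans hwW
  have h2 : κ.A₂ * W * U ^ 2 * |(h : ℝ)| ≤ κ.A₂ * W * c / Real.log 4 := by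
    have := hkl.mul_le (mul_nonneg hA₂ hW)
    simpa [mul_assoc] using this
  refine GeomConstants.weaken main ?_ le_rfl le_rfl le_rfl (by norm_num) (by norm_num) (by norm_num)
  gcongr 4.4267 + ?_
  exact max_le_max hs₀ (max_le_max hs₁ h2)

/-- **Frame form on the certified window**: a frame `K` with `FrameGeometry a₀ a₁ A b ē μ K`, `ē ≥ 0.0899`,
`a₀ ≤ 0.04495`, `0 ≤ a₁ ≤ 0.001158`, `b ≤ 0.01` gives the renormalised band `e_K = ε - μ - K` of the cell's
model-bound carrier the constants `(4.4267 + A, 0.04495, 0.577842, 0.0169)` — whatever the size `A` of `‖D²K‖`. -/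
theorem geomConstants_frameLevel_window {μ a₀ a₁ A b ebar : ℝ} {K : TrigPolyC4v}
    (hμ : μ ∈ Icc (-0.4267 : ℝ) (-0.1798)) (hK : FrameGeometry a₀ a₁ A b ebar μ K)
    (hebar : 0.0899 ≤ ebar) (ha₀ : a₀ ≤ 0.04495) (ha₁0 : 0 ≤ a₁) (ha₁ : a₁ ≤ 0.001158) (hb : b ≤ 0.01) :
    GeomConstants (frameLevel μ K) (4.4267 + A) 0.04495 0.577842 0.0169 := by
  obtain ⟨hC, h0, h1, hA, hfloor⟩ := hK
  have hG0 := klfs_window_geomConstants hμ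
  have hwb := window_wmin_bound ha₁0 ha₁ hb
  have hw' : 0 < 0.0449 * (1 - a₁ / 0.579) ^ 2 - 4.4267 * (a₁ / 0.579) * (2 + 3 * (a₁ / 0.579)) - b := by
    linarith
  have hfl : ∀ p : Momentum, |squareDispersion 1 0 p - μ| < 0.0899 → ∀ t : Momentum,
      inner ℝ (gradient ((fun q : Momentum => squareDispersion 1 0 q - μ) + frameShift K) p) t = 0 →
        -b * ‖t‖ ^ 2 ≤ hessQuad (frameShift K) p t := by
    intro p hp t ht
    rw [← frameLevel_eq_add] at ht
    exact hfloor p (hp.trans_le hebar) t ht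
  have main := GeomConstants.of_perturbation hG0 (klfs_contDiff_e μ) hC h0 h1 hA hfl (by linarith) ha₁0
    (by linarith) hw'
  rw [frameLevel_eq_add]
  exact GeomConstants.weaken main le_rfl (by linarith) (by linarith) hwb (by norm_num) (by norm_num) (by norm_num)

end Summit.HubbardSuperconductivity.HubbardSuperconductivity.Theorems.DispersionFlow

end
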